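import Literature.NumberTheory.Transcendental.KZLogCalculusProofs
import Literature.NumberTheory.Transcendental.KZProductIdeal
import Literature.NumberTheory.Transcendental.EllIterRep
import Literature.NumberTheory.Transcendental.SemialgebraicLineDeriv

/-!
# Bottom cell of the Chebyshev ladder — the fibre substitution (crux `HurwitzSectorComplement`,
# line `chebyshev-level-deformation`, stub S2b `stub_bottomCell`, auxiliary file)

The bottom representation of the Chebyshev ladder is
`𝔘_{1,k+1}(v₀) = [(0,1)_x × {0 < y_0 < ⋯ < y_k < v₀}, (∏ 2/(1+y_i²)) · U(y_0, x)]` with the kernel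
`U(v,x) = 2v/((1−x)² + v²(1+x)²)`. Its `x`-fibre is an arctan arc: the substitution
`t = y_0 (1 + x)/(1 − x)` maps `x ∈ (0,1)` onto `t ∈ (y_0, ∞)` and satisfies EXACTLY
`U(y_0, x) dx = dt/(1 + t²)` (`dt/dx = 2y_0/(1−x)²`, `1 + t² = ((1−x)² + y_0²(1+x)²)/(1−x)²`).
This file proves that this fibrewise substitution along the last coordinate is ONE
change-of-variables move of the Kontsevich–Zagier calculus (`bottomCov_mem_relations`, closed
form `of_sub_of_mem_relations_bottomCov` — the registered sub-goal;
Jacobian `y_0 · 2/(1−x)²` by `LinearMap.det_of_snoc_init`), and records the elementary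
representations used by the bottom cell: bounded semialgebraic domains weighted by
`q · ∏ 2/(1+x_i²)` (`exists_weightRep`), increasing chains over an interval with algebraic
end-points (`isSemialgebraic_chain`, `isBounded_chain`), and the rotation of coordinates turning
`{(y, t) | 0 < t < y_0 < ⋯ < y_n < v}` into the increasing chain of length `n + 2`
(`rotate_chain_iff`). (Algebraicity of `tan(πj/L)` is Mathlib's `Real.isAlgebraic_tan_rat_mul_pi`,
used by the main file.)

References: M. Kontsevich, D. Zagier, *Periods* (2001), §1.2, rules (1)–(2).
-/

noncomputable section

open Set MeasureTheory
open scoped BigOperators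
open Literature.NumberTheory.Transcendental
open Literature.ModelTheory.ExponentialFields (IsSemialgebraic)

namespace Summit.KontsevichZagierPeriods.Theorems.HurwitzMicroSectorsHurwitzSectorComplement

/-- **The fibre substitution of the bottom cell is a change-of-variables move.** Over a base
`G ⊆ ℝⁿ⁺¹` on which `y 0 > 0`, for a representation `R` on `G × (0,1)` (last coordinate `x`)
with integrand `H(y) · U(y 0, x)`, `U(v,x) = 2v/((1−x)²+v²(1+x)²)`, and a representation `R'` on
`{(y,t) | y ∈ G, y 0 < t}` with integrand `H(y)/(1+t²)`, `[R] − [R']` is Kontsevich–Zagier's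
rule (2) along `Φ(y, x) = (y, y 0 · (1+x)/(1−x))` (a `ℚ`-semialgebraic injective map with
Jacobian determinant `y 0 · 2/(1−x)² > 0`, `LinearMap.det_of_snoc_init`), hence a relation.
[cite: KontsevichZagier2001, §1.2] -/
theorem bottomCov_mem_relations {n : ℕ} {G : Set (Fin (n + 1) → ℝ)}
    (hGpos : ∀ y ∈ G, 0 < y 0) (H : (Fin (n + 1) → ℝ) → ℝ)
    (R R' : KZ.IntegralRep (n + 1 + 1))
    (hR : R.domain = {w : Fin (n + 1 + 1) → ℝ |
      (Fin.init w : Fin (n + 1) → ℝ) ∈ G ∧ w (Fin.last (n + 1)) ∈ Ioo (0:ℝ) 1})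
    (hRi : ∀ w ∈ R.domain, R.integrand w = H (Fin.init w) *
      (2 * Fin.init w 0 / ((1 - w (Fin.last (n + 1))) ^ 2 +
        (Fin.init w 0) ^ 2 * (1 + w (Fin.last (n + 1))) ^ 2)))
    (hR' : R'.domain = {w : Fin (n + 1 + 1) → ℝ |
      (Fin.init w : Fin (n + 1) → ℝ) ∈ G ∧ Fin.init w 0 < w (Fin.last (n + 1))})
    (hR'i : ∀ w ∈ R'.domain,
      R'.integrand w = H (Fin.init w) * (1 / (1 + (w (Fin.last (n + 1))) ^ 2))) :
    KZ.of R - KZ.of R' ∈ KZ.relations := by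
  have hmemG : ∀ w ∈ R.domain, Fin.init w ∈ G := fun w hw => by
    rw [hR] at hw
    exact hw.1
  have hx : ∀ w ∈ R.domain, w (Fin.last (n + 1)) ∈ Ioo (0:ℝ) 1 := fun w hw => by
    rw [hR] at hw
    exact hw.2
  -- the substitution
  set Φ : (Fin (n + 1 + 1) → ℝ) → (Fin (n + 1 + 1) → ℝ) := fun w =>
    Fin.snoc (Fin.init w)
      (Fin.init w 0 * ((1 + w (Fin.last (n + 1))) / (1 - w (Fin.last (n + 1))))) with hΦ
  -- continuous linear pieces
  let lastL : (Fin (n + 1 + 1) → ℝ) →L[ℝ] ℝ := ContinuousLinearMap.proj (Fin.last (n + 1))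
  let zeroL : (Fin (n + 1 + 1) → ℝ) →L[ℝ] ℝ := ContinuousLinearMap.proj (Fin.castSucc 0)
  have hlastL : ∀ w, lastL w = w (Fin.last (n + 1)) := fun w => rfl
  have hzeroL : ∀ w, zeroL w = Fin.init w 0 := fun w => rfl
  let row : (Fin (n + 1 + 1) → ℝ) → (Fin (n + 1 + 1) → ℝ) →L[ℝ] ℝ := fun z =>
    ((1 + z (Fin.last (n + 1))) / (1 - z (Fin.last (n + 1)))) • zeroL +
      (Fin.init z 0 * (2 / (1 - z (Fin.last (n + 1))) ^ 2)) • lastL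
  have hrow : ∀ z w, row z w =
      (1 + z (Fin.last (n + 1))) / (1 - z (Fin.last (n + 1))) * Fin.init w 0 +
        Fin.init z 0 * (2 / (1 - z (Fin.last (n + 1))) ^ 2) * w (Fin.last (n + 1)) := by
    intro z w
    simp [row, hzeroL, hlastL]
  let Φ' : (Fin (n + 1 + 1) → ℝ) → (Fin (n + 1 + 1) → ℝ) →L[ℝ] (Fin (n + 1 + 1) → ℝ) := fun z =>
    ContinuousLinearMap.pi
      (Fin.lastCases (motive := fun _ => (Fin (n + 1 + 1) → ℝ) →L[ℝ] ℝ) (row z)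
        (fun i => ContinuousLinearMap.proj (Fin.castSucc i)))
  have hΦ' : ∀ z w, Φ' z w = Fin.snoc (Fin.init w) (row z w) := by
    intro z w
    funext i
    refine Fin.lastCases ?_ (fun j => ?_) i
    · simp [Φ']
    · simp [Φ', Fin.init]
  -- determinant
  have hdet : ∀ z, (Φ' z).det = Fin.init z 0 * (2 / (1 - z (Fin.last (n + 1))) ^ 2) := by
    intro z
    have h := LinearMap.det_of_snoc_init
      (Φ' z : (Fin (n + 1 + 1) → ℝ) →ₗ[ℝ] (Fin (n + 1 + 1) → ℝ)) LinearMap.id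
      (((1 + z (Fin.last (n + 1))) / (1 - z (Fin.last (n + 1)))) •
        (LinearMap.proj 0 : (Fin (n + 1) → ℝ) →ₗ[ℝ] ℝ))
      (Fin.init z 0 * (2 / (1 - z (Fin.last (n + 1))) ^ 2)) (fun w => by
        rw [ContinuousLinearMap.coe_coe, hΦ', hrow]
        simp)
    rw [LinearMap.det_id, mul_one] at h
    exact h
  -- derivative
  have hderiv : ∀ z : Fin (n + 1 + 1) → ℝ, z (Fin.last (n + 1)) < 1 → HasFDerivAt Φ (Φ' z) z := by
    intro z hz1
    have hsub : (1 - z (Fin.last (n + 1))) ≠ 0 := by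
      have : 0 < 1 - z (Fin.last (n + 1)) := by linarith
      exact this.ne'
    rw [hasFDerivAt_pi']
    intro i
    refine Fin.lastCases ?_ (fun j => ?_) i
    · have hl : HasFDerivAt (fun x : Fin (n + 1 + 1) → ℝ => x (Fin.last (n + 1))) lastL z :=
        hasFDerivAt_apply (Fin.last (n + 1)) z
      have h0 : HasFDerivAt (fun x : Fin (n + 1 + 1) → ℝ => Fin.init x 0) zeroL z :=
        hasFDerivAt_apply (Fin.castSucc 0) z
      have hm1 : HasDerivAt (fun x : ℝ => (1 + x) / (1 - x))
          (2 / (1 - z (Fin.last (n + 1))) ^ 2) (z (Fin.last (n + 1))) := by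
        have h := ((hasDerivAt_id' (z (Fin.last (n + 1)))).const_add 1).div
          ((hasDerivAt_id' (z (Fin.last (n + 1)))).const_sub 1) hsub
        refine h.congr_deriv ?_
        field_simp
        ring
      have hm : HasFDerivAt
          ((fun x : ℝ => (1 + x) / (1 - x)) ∘ fun x : Fin (n + 1 + 1) → ℝ => x (Fin.last (n + 1)))
          ((2 / (1 - z (Fin.last (n + 1))) ^ 2) • lastL) z :=
        hm1.comp_hasFDerivAt z hl
      have h := h0.mul hm
      have hfun : (fun x => Φ x (Fin.last (n + 1))) =
          fun x => Fin.init x 0 *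
            ((fun x : ℝ => (1 + x) / (1 - x)) ∘
              fun x : Fin (n + 1 + 1) → ℝ => x (Fin.last (n + 1))) x := by
        funext x
        simp [hΦ]
      show HasFDerivAt (fun x => Φ x (Fin.last (n + 1))) _ z
      rw [hfun]
      refine h.congr_fderiv (ContinuousLinearMap.ext fun w => ?_)
      simp only [ContinuousLinearMap.coe_comp, Function.comp_apply, hΦ', hrow]
      simp [hzeroL, hlastL]
      ring
    · have hfun : (fun x => Φ x (Fin.castSucc j)) = fun x => x (Fin.castSucc j) := by
        funext x
        simp [hΦ, Fin.init]
      show HasFDerivAt (fun x => Φ x (Fin.castSucc j)) _ z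
      rw [hfun]
      refine (hasFDerivAt_apply (Fin.castSucc j) z).congr_fderiv
        (ContinuousLinearMap.ext fun w => ?_)
      simp [hΦ', Fin.init]
  -- `Φ` maps `R.domain` into `R'.domain`
  have hmaps : ∀ z ∈ R.domain, Φ z ∈ R'.domain := by
    intro z hz
    have hy := hmemG z hz
    have hxz := hx z hz
    have hy0 := hGpos _ hy
    rw [hR']
    refine ⟨by simpa [hΦ] using hy, ?_⟩
    simp only [hΦ, Fin.init_snoc, Fin.snoc_last]
    have h1x : 0 < 1 - z (Fin.last (n + 1)) := by linarith [hxz.2]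
    rw [lt_mul_iff_one_lt_right hy0, one_lt_div h1x]
    linarith [hxz.1]
  refine KZ.changeOfVariablesRel_subset_relations ⟨n + 1 + 1, R, R', Φ, Φ', ?_, ?_, ?_, ?_, ?_, rfl⟩
  · -- semialgebraic map
    refine (isSemialgebraicMapOn_iff_forall_holds R.isSemialgebraic_domain).mpr fun i => ?_
    refine Fin.lastCases ?_ (fun j => ?_) i
    · refine (isSemialgebraicFunOn_aeval_div_aeval R.isSemialgebraic_domain
        (MvPolynomial.X (Fin.castSucc 0) * (1 + MvPolynomial.X (Fin.last (n + 1))))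
        (1 - MvPolynomial.X (Fin.last (n + 1))) (fun w hw => ?_)).congr fun w _ => ?_
      · have := (hx w hw).2
        simp only [map_sub, map_one, MvPolynomial.aeval_X]
        linarith
      · simp only [map_mul, map_add, map_sub, map_one, MvPolynomial.aeval_X, hΦ, Fin.snoc_last]
        simp only [Fin.init]
        ring
    · exact (isSemialgebraicFunOn_aeval R.isSemialgebraic_domain
        (MvPolynomial.X (Fin.castSucc j))).congr fun z _ => by simp [hΦ, Fin.init]
  · exact fun z hz => (hderiv z (hx z hz).2).hasFDerivWithinAt
  · -- injectivity
    intro z₁ hz₁ z₂ hz₂ h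
    have hy : Fin.init z₁ = Fin.init z₂ := by
      have := congrArg Fin.init h
      simpa [hΦ] using this
    have hl : Fin.init z₁ 0 * ((1 + z₁ (Fin.last (n + 1))) / (1 - z₁ (Fin.last (n + 1)))) =
        Fin.init z₂ 0 * ((1 + z₂ (Fin.last (n + 1))) / (1 - z₂ (Fin.last (n + 1)))) := by
      have := congrFun h (Fin.last (n + 1))
      simpa [hΦ] using this
    rw [hy] at hl
    have hy0 : 0 < Fin.init z₂ 0 := hGpos _ (hmemG z₂ hz₂)
    have hm := mul_left_cancel₀ hy0.ne' hl
    have h1 : 1 - z₁ (Fin.last (n + 1)) ≠ 0 := by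
      have := (hx z₁ hz₁).2
      exact (sub_pos.mpr this).ne'
    have h2 : 1 - z₂ (Fin.last (n + 1)) ≠ 0 := by
      have := (hx z₂ hz₂).2
      exact (sub_pos.mpr this).ne'
    rw [div_eq_div_iff h1 h2] at hm
    have hs : z₁ (Fin.last (n + 1)) = z₂ (Fin.last (n + 1)) := by linarith
    rw [← Fin.snoc_init_self z₁, ← Fin.snoc_init_self z₂, hy, hs]
  · -- image
    ext w
    simp only [mem_image]
    constructor
    · intro hw
      rw [hR'] at hw
      obtain ⟨hyG, ht⟩ := hw
      have hy0 := hGpos _ hyG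
      refine ⟨Fin.snoc (Fin.init w)
        ((w (Fin.last (n + 1)) - Fin.init w 0) / (w (Fin.last (n + 1)) + Fin.init w 0)), ?_, ?_⟩
      · rw [hR]
        refine ⟨by simpa using hyG, ?_, ?_⟩
        · simp only [Fin.snoc_last]
          exact div_pos (by linarith) (by linarith)
        · simp only [Fin.snoc_last]
          rw [div_lt_one (by linarith)]
          linarith
      · simp only [hΦ, Fin.init_snoc, Fin.snoc_last]
        have hne : w (Fin.last (n + 1)) + Fin.init w 0 ≠ 0 := by
          have : 0 < w (Fin.last (n + 1)) + Fin.init w 0 := by linarith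
          exact this.ne'
        have hy0' : Fin.init w 0 ≠ 0 := hy0.ne'
        have e1 :
            1 + (w (Fin.last (n + 1)) - Fin.init w 0) / (w (Fin.last (n + 1)) + Fin.init w 0) =
              2 * w (Fin.last (n + 1)) / (w (Fin.last (n + 1)) + Fin.init w 0) := by
          rw [add_div' _ _ _ hne]
          congr 1
          ring
        have e2 :
            1 - (w (Fin.last (n + 1)) - Fin.init w 0) / (w (Fin.last (n + 1)) + Fin.init w 0) =
              2 * Fin.init w 0 / (w (Fin.last (n + 1)) + Fin.init w 0) := by
          rw [sub_div' hne]
          congr 1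
          ring
        rw [e1, e2, div_div_div_cancel_right₀ hne, mul_div_mul_left _ _ two_ne_zero,
          ← mul_div_assoc, mul_div_cancel_left₀ _ hy0']
        exact Fin.snoc_init_self w
    · rintro ⟨z, hz, rfl⟩
      exact hmaps z hz
  · -- integrand
    intro z hz
    have hy := hmemG z hz
    have hxz := hx z hz
    have hy0 := hGpos _ hy
    have h1x : 0 < 1 - z (Fin.last (n + 1)) := by linarith [hxz.2]
    rw [hRi z hz, hR'i _ (hmaps z hz), hdet,
      abs_of_pos (mul_pos hy0 (div_pos two_pos (pow_pos h1x 2)))]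
    simp only [hΦ, Fin.init_snoc, Fin.snoc_last]
    have h1 : 1 - z (Fin.last (n + 1)) ≠ 0 := h1x.ne'
    have h2 : (1 - z (Fin.last (n + 1))) ^ 2 +
        (Fin.init z 0) ^ 2 * (1 + z (Fin.last (n + 1))) ^ 2 ≠ 0 := by
      positivity
    have h3 : 1 + (Fin.init z 0 *
        ((1 + z (Fin.last (n + 1))) / (1 - z (Fin.last (n + 1))))) ^ 2 ≠ 0 := by
      positivity
    field_simp

/-- **The fibre substitution of the bottom cell is a change-of-variables move** (registered
sub-goal of stub S2b, closed form of `bottomCov_mem_relations`): over a base `G ⊆ ℝⁿ⁺¹` with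
`y 0 > 0`, `[G × (0,1), H(y)·U(y 0, x)] − [{(y,t) | y ∈ G, t > y 0}, H(y)/(1+t²)]` is a relation
of the Kontsevich–Zagier calculus (rule (2) along `t = y 0 · (1+x)/(1−x)`).
[cite: KontsevichZagier2001, §1.2] -/
theorem of_sub_of_mem_relations_bottomCov :
    ∀ {n : ℕ} {G : Set (Fin (n + 1) → ℝ)}, (∀ y ∈ G, 0 < y 0) → ∀ (H : (Fin (n + 1) → ℝ) → ℝ)
      (R R' : KZ.IntegralRep (n + 1 + 1)),
      R.domain = {w : Fin (n + 1 + 1) → ℝ |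
        (Fin.init w : Fin (n + 1) → ℝ) ∈ G ∧ w (Fin.last (n + 1)) ∈ Set.Ioo (0:ℝ) 1} →
      (∀ w ∈ R.domain, R.integrand w = H (Fin.init w) *
        (2 * Fin.init w 0 / ((1 - w (Fin.last (n + 1))) ^ 2 +
          (Fin.init w 0) ^ 2 * (1 + w (Fin.last (n + 1))) ^ 2))) →
      R'.domain = {w : Fin (n + 1 + 1) → ℝ |
        (Fin.init w : Fin (n + 1) → ℝ) ∈ G ∧ Fin.init w 0 < w (Fin.last (n + 1))} →
      (∀ w ∈ R'.domain, R'.integrand w = H (Fin.init w) * (1 / (1 + (w (Fin.last (n + 1))) ^ 2))) →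
      KZ.of R - KZ.of R' ∈ KZ.relations :=
  @bottomCov_mem_relations

/-! ## Elementary representations and sets of the bottom cell -/

/-- A bounded `ℚ`-semialgebraic domain weighted by `q · ∏ 2/(1+x_i²)` (`q ∈ ℚ`) is an integral
representation: the weight is a quotient of rational polynomials, continuous, hence integrable on
the compact closure. [folklore] -/
theorem exists_weightRep {a : ℕ} {D : Set (Fin a → ℝ)} (hD : IsSemialgebraic ℚ D)
    (hDb : Bornology.IsBounded D) (q : ℚ) :
    ∃ S : KZ.IntegralRep a, S.domain = D ∧
      S.integrand = fun x => (q : ℝ) * ∏ i, 2 / (1 + (x i) ^ 2) := by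
  have hsa : IsSemialgebraicFunOn ℚ D
      (fun x : Fin a → ℝ => (q : ℝ) * ∏ i, 2 / (1 + (x i) ^ 2)) := by
    refine (isSemialgebraicFunOn_const_ratCast hD q).fun_mul
      (IsSemialgebraicFunOn.fun_finsetProd Finset.univ hD fun i _ => ?_)
    refine (isSemialgebraicFunOn_aeval_div_aeval hD (MvPolynomial.C 2) (1 + MvPolynomial.X i ^ 2)
      fun x _ => ?_).congr fun x _ => ?_
    · simp only [map_add, map_one, map_pow, MvPolynomial.aeval_X]
      positivity
    · simp
  have hcont : Continuous fun x : Fin a → ℝ => (q : ℝ) * ∏ i, 2 / (1 + (x i) ^ 2) :=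
    continuous_const.mul (continuous_finsetProd _ fun i _ =>
      continuous_const.div (continuous_const.add ((continuous_apply i).pow 2))
        fun x => by positivity)
  refine ⟨⟨D, fun x => (q : ℝ) * ∏ i, 2 / (1 + (x i) ^ 2), hD, hsa, ?_⟩, rfl, rfl⟩
  exact (hcont.continuousOn.integrableOn_compact hDb.isCompact_closure).mono_set subset_closure

/-- The increasing chain `{lo < y_0 < ⋯ < y_{a-1} < hi}` (spelled `∀ i, lo < y i < hi` and
`i < i' → y i < y i'`) with real algebraic end-points is `ℚ`-semialgebraic. [folklore] -/
theorem isSemialgebraic_chain (a : ℕ) {lo hi : ℝ} (hlo : IsAlgebraic ℚ lo)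
    (hhi : IsAlgebraic ℚ hi) :
    IsSemialgebraic ℚ {y : Fin a → ℝ | (∀ i, lo < y i ∧ y i < hi) ∧
      ∀ i i' : Fin a, i < i' → y i < y i'} := by
  have h1 : IsSemialgebraic ℚ {y : Fin a → ℝ | ∀ i, lo < y i ∧ y i < hi} := by
    have : {y : Fin a → ℝ | ∀ i, lo < y i ∧ y i < hi} =
        ⋂ i ∈ (Finset.univ : Finset (Fin a)), ({y : Fin a → ℝ | lo < y i} ∩ {y | y i < hi}) := by
      ext y
      simp
    rw [this]
    exact IsSemialgebraic.biInter _ _ fun i _ =>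
      (KZ.isSemialgebraic_setOf_const_lt_apply hlo i).inter
        (KZ.isSemialgebraic_setOf_apply_lt_const hhi i)
  have h : {y : Fin a → ℝ | (∀ i, lo < y i ∧ y i < hi) ∧ ∀ i i' : Fin a, i < i' → y i < y i'} =
      {y : Fin a → ℝ | ∀ i, lo < y i ∧ y i < hi} ∩ {y | StrictMono y} := by
    ext y
    simp only [mem_setOf_eq, mem_inter_iff]
    exact ⟨fun h => ⟨h.1, fun a b hab => h.2 a b hab⟩, fun h => ⟨h.1, fun a b hab => h.2 hab⟩⟩
  rw [h]
  exact h1.inter (KZ.isSemialgebraic_setOf_strictMono a)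

/-- The chain over a bounded interval is bounded. [folklore] -/
theorem isBounded_chain (a : ℕ) (lo hi : ℝ) :
    Bornology.IsBounded {y : Fin a → ℝ | (∀ i, lo < y i ∧ y i < hi) ∧
      ∀ i i' : Fin a, i < i' → y i < y i'} :=
  (Metric.isBounded_Icc (fun _ : Fin a => lo) (fun _ => hi)).subset fun _ hy =>
    ⟨fun i => (hy.1 i).1.le, fun i => (hy.1 i).2.le⟩

/-- The open unit box is bounded. [folklore] -/
theorem isBounded_unitBox (a : ℕ) :
    Bornology.IsBounded {x : Fin a → ℝ | ∀ i, x i ∈ Ioo (0:ℝ) 1} :=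
  (Metric.isBounded_Icc (0 : Fin a → ℝ) 1).subset fun _ hx =>
    ⟨fun i => (hx i).1.le, fun i => (hx i).2.le⟩

/-- Rotating the coordinates `(y_0, …, y_n, t) ↦ (t, y_0, …, y_n)`: the cell
`{0 < t < y_0, y an increasing chain in (0, v)}` becomes the increasing chain of length `n + 2`
in `(0, v)`. [folklore] -/
theorem rotate_chain_iff (n : ℕ) (v : ℝ) (c : Fin (n + 1 + 1) → ℝ) :
    (((∀ i : Fin (n + 1), 0 < c i.succ ∧ c i.succ < v) ∧
        ∀ i i' : Fin (n + 1), i < i' → c i.succ < c i'.succ) ∧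
      0 < c 0 ∧ c 0 < c 1) ↔
    ((∀ i, 0 < c i ∧ c i < v) ∧ ∀ i i' : Fin (n + 1 + 1), i < i' → c i < c i') := by
  constructor
  · rintro ⟨⟨hb, hm⟩, h0, h01⟩
    have hmono : StrictMono c := by
      rw [Fin.strictMono_iff_lt_succ]
      intro i
      refine Fin.cases ?_ (fun j => ?_) i
      · simpa using h01
      · rw [Fin.castSucc_succ]
        exact hm _ _ Fin.castSucc_lt_succ
    refine ⟨fun i => ?_, fun i i' h => hmono h⟩
    refine Fin.cases ?_ (fun j => hb j) i
    have h1 : c 1 < v := by simpa using (hb 0).2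
    exact ⟨h0, h01.trans h1⟩
  · rintro ⟨hb, hm⟩
    refine ⟨⟨fun i => hb i.succ, fun i i' h => hm _ _ (Fin.succ_lt_succ_iff.mpr h)⟩, (hb 0).1, ?_⟩
    simpa using hm 0 (Fin.succ 0) (Fin.succ_pos 0)

end Summit.KontsevichZagierPeriods.Theorems.HurwitzMicroSectorsHurwitzSectorComplement

end
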